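import Literature.MathematicalPhysics.QuantumFieldTheory.Balaban1983to89.HiggsCondCov232
import Literature.MathematicalPhysics.QuantumFieldTheory.Balaban1983to89.B1Eq243HiggsModel

/-!
# `Balaban1983to89.B2Eq227CondDelta` — T. Bałaban, *(Higgs)₂,₃ quantum fields in a finite volume. II. An upper bound*,
Commun. Math. Phys. **86** (1982) 555–594 [Balaban1982Higgs2] p. 562: the new quadratic form **(2.27)**
`⟨ψ, Δ^{(k+1),L}_Λ(Ω,A)ψ⟩ = aL^{d−2}Σ_{y∈Λ′}|ψ(y)|² − a²L^{−4}⟨ψ, Q(A)C^{(k)}_Λ(Ω,A)Q^*(A)ψ⟩` of the field `ψ` after the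
conditional integration over `Λ`, AT A GENERAL LEVEL `k` and ON THE CONCRETE (Higgs)₂,₃ CARRIER (the scales `L^kε` kept, as
in Sect. 2.B pp. 566–569 where (2.46) uses `Δ^{(k)}_{Λ₅}(B^{k−1}(Λ₂^{(k−1)}), A^{(k),ε})`); and the consistency **«(2.27) on the
whole lattice `Λ = T^{(k)}` IS part I's (2.21) one level up»**, PROVED for the concrete operators at every level

statement-level skeleton of published theorems with citation tags; proofs where landed; nothing here is a claim about the Yang–Mills mass gap

PDFs held: `paper:balaban1982-cmp86-higgs23-ii` (journal page = PDF page + 554), pp. 562, 567 [PDF 8, 13];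
`paper:balaban1982-cmp85-higgs23-i` (journal page = PDF page + 602), pp. 610–612 [PDF 8–10] — read AS IMAGES on the ×2 renders
`run/shared/lean/pub/pub-balaban/b2b-balaban-ref1/pages/1982-cmp86-higgs23-II/1982-cmp86-higgs23-II-p008-x2.png`, `-p013-x2.png`,
`…/1982-cmp85-higgs23-I/1982-cmp85-higgs23-I-p008-x2.png` … `-p010-x2.png`.

CITATION HEADER (lean-in-tree rule).  lit-balaban typed skeleton (HOME `run/shared/lean/pub/lit-balaban/`), typer line
(concrete carriers), gen 5, file A of the (2.45)→(2.46) pair (file B `B2Eq246ScalarStep`: the conditional integration of the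
k-th step, scalar factor).  SKELETON rows served: **B2.Eq2.42** member (2.27) (fold owner r02; the operator Δ^{(k+1),L}_Λ of
record is r02's matrix-level `B2Eq224FirstStepFields.delta227` at the first step, bridged to p15's `B2Eq234Exponent.form227`;
HERE: every level `k`, the concrete objects) and **B2.Eq2.44** (the typer cells (2.45)/(2.46): the term
`−½⟨φ, Δ^{(k)}_{Λ₅}(B^{k−1}(Λ₂^{(k−1)}), A^{(k),ε})φ⟩` of (2.46) p. 567), with the knitting to **B1.Eq2.21**.  NOTHING of record is
restated: `C^{(k)}_Λ(Ω,A)` IS the typer's `HiggsCondCov232.condCov232` (I (2.32)), `Q(A)`, `Q^*(A)` ARE p35's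
`B1Eq27StepAdjoint.avgQLin/avgQAdjLin`, `Λ′ ↦ Λ = B(Λ′)` IS `HiggsLattice.blockSet`, the cut `Λ′ψ` IS `B2Eq255Concrete.cutToLin`,
`Δ^{(k),L^kε}(Ω,A)` IS p35's `B1Eq230FluctCov.deltaKA`, the step algebra IS b2b's `B1RG242.StepData.display221_succ`.
THE SOURCE TEXT, p. 562 [PDF 8], verbatim: *"where the new quadratic form Δ^{(1),L}_{Λ₃}(B^{(1)}) for the field ψ is defined
by the general formula ⟨ψ, Δ^{(k+1),L}_Λ(Ω, A)ψ⟩ = aL^{d−2} Σ_{y∈Λ′} |ψ(y)|² − a²L^{−4}⟨ψ, Q(A)C^{(k)}_Λ(Ω, A)Q^*(A)ψ⟩,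
Λ ⊂ Ω^{(k)}, (2.27) and the similar formula holds for the vector field."*; p. 567 [PDF 13], (2.46): *"… − ½⟨φ,
Δ^{(k),L^kε}_{Λ₅^{(k−1)}}(B^{k−1}(Λ₂^{(k−1)}), A^{(k),ε})φ⟩] · Z^{(k−1),L^{k−1}ε}_{Λ₅^{(k−1)}} Z^{(k−1),L^{k−1}ε}_{Λ₅^{(k−1)}}(B^{k−1}(Λ₂^{(k−1)}),
A^{(k),ε})"*; part I p. 611 [PDF 9]: *"C^{(k)}_Λ(Ω, A) = ((aL^{−2}P(A) + Δ^{(k)}(Ω, A))↾_Λ)^{−1}. (2.32) Here we will assume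
that the set Λ is a union of big blocks of T₁^{(k)}"*; p. 610 [PDF 8]: *"⟨ψ, Δ^{(k),L^kε}(Ω,A)ψ⟩ = a_k(L^kε)^{−2}⟨ψ,ψ⟩ −
a_k²(L^kε)^{−4}⟨ψ, Q_k(A)G^ε_k(Ω,A)Q_k^*(A)ψ⟩ (2.21)"*; p. 612 [PDF 10]: *"Using the identity G^ε_1(Ω,A) = C^{(0),ε}(Ω,A)"*.
READING OF THE SCALES.  (2.27) is printed on the unit lattice of the first step (`aL^{d−2}Σ_{y∈Λ′}|ψ(y)|² = aL^{−2}‖Λ′ψ‖²`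
for the `L`-lattice norm); Sect. 2.B keeps the scales, and the coefficient of the `k`-th step is `a(L^{k+1}ε)^{−2}` (I (2.30):
`C^{(k),L^kε}(Ω,A) = (a(L^{k+1}ε)^{−2}P(A) + Δ^{(k),L^kε}(Ω,A))^{−1}`), so here
`Δ^{(k+1),L^{k+1}ε}_Λ(Ω,A) := a(L^{k+1}ε)^{−2}·Λ′ − a²(L^{k+1}ε)^{−4}·Q(A)C^{(k),L^kε}_Λ(Ω,A)Q^*(A)` on the fields of `T^{(k+1)}`,
with `‖Λ′ψ‖²` for (1.5) `= (L^{k+1}ε)^dΣ_{y∈Λ′}|ψ(y)|²`, i.e. the printed first term with `aL^{d−2}` ↦ `a(L^{k+1}ε)^{d−2}`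
(`siteInner_condDelta227_printed`, `B1RT.prec`).

WHAT THIS FILE PROVES (0 sorry; standard axioms; definitions with bodies + theorems).
§1 `stepCoef P a k = a(L^{k+1}ε)^{−2}` (the coefficient of I (2.30), p35's `precOpA` = `stepCoef • P(A) + Δ^{(k)}` —
   `precOpA_eq`); **(2.27)** `condDelta227 C Ω A msq a k Λ′` (DEFINITION WITH BODY, `Λ = blockSet Λ′` a union of blocks as
   the print requires); the printed form identity `siteInner_condDelta227` / `siteInner_condDelta227_printed`; symmetry for
   (1.5) (`siteInner_condDelta227_comm`); the vector-field reading *"the similar formula holds for the vector field"* at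
   `N = d`, `A = 0` (`condDelta227_zero_field`, through p35's `precOpA_zero_field` line: the covariance is the typer's
   `HiggsFluctMeasure` one).
§2 **`Λ = T^{(k)}`: (2.27) IS (I.2.21) AT LEVEL `k + 1`** — `condDelta227 C Ω A msq a k univ = deltaKA C Ω A msq a (k+1)`
   (`condDelta227_univ_eq_deltaKA`; m² > 0, a > 0, L > 1, k < K; every `Ω`, `A`, `C`): at `k = 0` by p35's «G₁ = C^{(0)}»
   (`B1Eq243HiggsModel.propagatorK_one`, a₁ = a), at `k ≥ 1` by b2b's KERNEL step algebra `B1RG242.StepData.display221_succ`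
   («the Schur complement β·1 − β²·QC^{(k)}Q^* of the k-th step form equals γ·1 − γ²·Q_{k+1}G_{k+1}Q^*_{k+1}») on p35's
   `B1Eq230FluctCov.stepData` with all its hypotheses discharged there — so the inductive definition I (2.18) of
   `Δ^{(k+1)}` by one more renormalization step agrees with the solved form (2.21), for the concrete covariant operators.
§3 (v1.1, typer gen 6) **(2.47) p. 568, its exact skeleton, FOR THE CONCRETE OPERATOR**: for every region `S ⊂ T^{(k+1)}`
   (`S` ↤ `Λ₆^{(k−1)′}`), `½⟨ψ, Δ_Λψ⟩ = ½⟨Sᶜψ, Δ_ΛSᶜψ⟩ + ⟨Sᶜψ, Δ_ΛSψ⟩ + ½⟨Sψ, Δ_ΛSψ⟩` with `Δ_Λ = condDelta227 …` and the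
   (1.5) scalar product (`half_siteInner_condDelta227_split`; the generic symmetric-operator algebra `half_siteInner_split`) —
   the concrete-carrier twin of r14's matrix-level `B2Sect2BDensities.eq247_exact`; the printed (2.47) then REPLACES operators
   and masks term by term at the cost `O((L^{k−1}ε)^κ)|Λ₆^{(k−1)}|` (r14 `eq247_of_replacements`, not re-proved here).
HONEST SCOPE.  (a) `Λ′` is any finite set of sites of `T^{(k+1)}` and `Λ = B(Λ′)` (the print: unions of BIG blocks — more
special); (b) operators act on fields on all of `T^{(k+1)}` resp. `T^{(k)}` (p35's convention: mass term everywhere, bonds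
outside `Ω` dropped), so only m² > 0 is covered by the existence statements; (c) nothing quantitative (no bounds on
`Δ^{(k+1)}_Λ`); (d) the conditional integration producing this form is file B.  Value = the concrete object the (2.46)/(2.53)
displays and III (1.16) carry, and one more consistency certificate of the B1 §2 recursion; NOT summit progress.
Unit `lit-balaban-typer` gen 5 (literature-prover-lit-balaban-typer-g5-0); HOME/FILED.md records the proposal.
-/

open scoped BigOperators InnerProductSpace

namespace Literature.MathematicalPhysics.QuantumFieldTheory.Balaban1983to89.B2Eq227CondDelta

open HiggsLattice HiggsAveraging HiggsCovariance HiggsCovariancePos HiggsFluctMeasure B1Eq27StepAdjoint B1Eq230FluctCov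
  B1Eq230FluctCovPos HiggsCondCov232 B2Eq255Concrete
open HiggsFluctMeasurePos (siteInner_comm siteInner_add_right siteInner_sub_right siteInner_smul_right siteInner_smul_left)

variable {P : HiggsLattice.Params} {N : ℕ}

/-! ## §1 (2.27) at level `k` on the concrete carrier -/

section Def

/-- **The coefficient `a(L^{k+1}ε)^{−2}`** of `P(A)` in I (2.30) and of `Λ′` in (2.27) at the `k`-th step (print, first step on the
unit lattice: `aL^{−2}`). [cite: Balaban1982Higgs1, (2.30) p.611] -/
noncomputable def stepCoef (P : HiggsLattice.Params) (a : ℝ) (k : ℕ) : ℝ := a * ((P.mesh (k + 1))⁻¹ ^ 2)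

/-- Unfolding (definitional). [cite: Balaban1982Higgs1, (2.30) p.611] -/
theorem stepCoef_eq (a : ℝ) (k : ℕ) : stepCoef P a k = a * ((P.mesh (k + 1))⁻¹ ^ 2) := rfl

/-- `a(L^{k+1}ε)^{−2} > 0` for `a > 0`. [cite: Balaban1982Higgs1, (2.30) p.611] -/
theorem stepCoef_pos {a : ℝ} (ha : 0 < a) (k : ℕ) : 0 < stepCoef P a k :=
  mul_pos ha (pow_pos (inv_pos.mpr (P.mesh_pos (k + 1))) 2)

/-- `a(L^{k+1}ε)^{−2}·(L^{k+1}ε)^d = a(L^{k+1}ε)^{d−2}` = the printed precision `B1RT.prec` of I (2.6) (the `aL^{d−2}` of (2.27)).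
[cite: Balaban1982Higgs2, (2.27) p.562] -/
theorem stepCoef_mul_mesh_pow (a : ℝ) (k : ℕ) :
    stepCoef P a k * P.mesh (k + 1) ^ P.d = B1RT.prec a (P.mesh (k + 1)) P.d := by
  have hm : P.mesh (k + 1) ≠ 0 := (P.mesh_pos (k + 1)).ne'
  rw [stepCoef, B1RT.prec_eq, zpow_sub₀ hm, zpow_natCast, inv_pow]
  have h2 : P.mesh (k + 1) ^ (2 : ℤ) = P.mesh (k + 1) ^ (2 : ℕ) := by norm_cast
  rw [h2]
  field_simp

/-- p35's operator of I (2.30) through the coefficient: `precOpA = a(L^{k+1}ε)^{−2}·P(A) + Δ^{(k),L^kε}(Ω,A)` (definitional).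
[cite: Balaban1982Higgs1, (2.30) p.611] -/
theorem precOpA_eq (C : ChargeData N) (Ω : Finset (HiggsLattice.Site P 0)) (A : HiggsLattice.VecField P 0) (msq a : ℝ) (k : ℕ) :
    precOpA C Ω A msq a k = stepCoef P a k • blockProjA C A k + deltaKA C Ω A msq a k := rfl

variable (C : ChargeData N) (Ω : Finset (HiggsLattice.Site P 0)) (A : HiggsLattice.VecField P 0) (msq a : ℝ)

/-- **(2.27)** p. 562 at the `k`-th step, ON THE CONCRETE CARRIER: the operator of the new quadratic form for the field `ψ` on
`T^{(k+1)}` after the conditional integration over `Λ = B(Λ′) ⊂ T^{(k)}`,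
`Δ^{(k+1),L^{k+1}ε}_Λ(Ω,A) = a(L^{k+1}ε)^{−2}·Λ′ − a²(L^{k+1}ε)^{−4}·Q(A)C^{(k),L^kε}_Λ(Ω,A)Q^*(A)`
(verbatim: *"⟨ψ, Δ^{(k+1),L}_Λ(Ω, A)ψ⟩ = aL^{d−2}Σ_{y∈Λ′}|ψ(y)|² − a²L^{−4}⟨ψ, Q(A)C^{(k)}_Λ(Ω, A)Q^*(A)ψ⟩, Λ ⊂ Ω^{(k)}"*;
`Λ′` = the sites of `T^{(k+1)}` whose block lies in `Λ`; the form identity is `siteInner_condDelta227_printed`).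
[cite: Balaban1982Higgs2, (2.27) p.562] -/
noncomputable def condDelta227 (k : ℕ) (Λ' : Finset (HiggsLattice.Site P (k + 1))) : Module.End ℝ (ScalarField P (k + 1) N) :=
  stepCoef P a k • (cutToLin Λ' : Module.End ℝ (ScalarField P (k + 1) N))
    - stepCoef P a k ^ 2 •
      ((avgQLin C A k : ScalarField P k N →ₗ[ℝ] ScalarField P (k + 1) N)
        ∘ₗ condCov232 C Ω A msq a k (blockSet Λ') ∘ₗ avgQAdjLin C A k)

/-- Pointwise action of (2.27): `Δ^{(k+1)}_Λψ = a(L^{k+1}ε)^{−2}Λ′ψ − a²(L^{k+1}ε)^{−4}Q(A)C^{(k)}_ΛQ^*(A)ψ`.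
[cite: Balaban1982Higgs2, (2.27) p.562] -/
theorem condDelta227_apply (k : ℕ) (Λ' : Finset (HiggsLattice.Site P (k + 1))) (ψ : ScalarField P (k + 1) N) :
    condDelta227 C Ω A msq a k Λ' ψ
      = stepCoef P a k • cutTo Λ' ψ
        - stepCoef P a k ^ 2 • avgQLin C A k (condCov232 C Ω A msq a k (blockSet Λ') (avgQAdjLin C A k ψ)) := rfl

/-- **The printed form identity (2.27)**, operator version: `⟨ψ, Δ^{(k+1)}_Λψ⟩ = a(L^{k+1}ε)^{−2}⟨Λ′ψ, Λ′ψ⟩ −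
a²(L^{k+1}ε)^{−4}⟨Q^*(A)ψ, C^{(k)}_Λ(Ω,A)Q^*(A)ψ⟩` (`Q^*` the (1.5)-adjoint of `Q`, p35's `siteInner_avgQLin`).
[cite: Balaban1982Higgs2, (2.27) p.562] -/
theorem siteInner_condDelta227 (k : ℕ) (Λ' : Finset (HiggsLattice.Site P (k + 1))) (ψ : ScalarField P (k + 1) N) :
    siteInner ψ (condDelta227 C Ω A msq a k Λ' ψ)
      = stepCoef P a k * siteInner (cutTo Λ' ψ) (cutTo Λ' ψ)
        - stepCoef P a k ^ 2 *
          siteInner (avgQAdjLin C A k ψ) (condCov232 C Ω A msq a k (blockSet Λ') (avgQAdjLin C A k ψ)) := by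
  rw [condDelta227_apply, siteInner_sub_right, siteInner_smul_right, siteInner_smul_right, ← siteInner_cutTo,
    ← siteInner_avgQAdjLin]

/-- `⟨Λ′ψ, Λ′ψ⟩ = (L^{k+1}ε)^d Σ_{y∈Λ′}|ψ(y)|²` for (1.5) on `T^{(k+1)}`. [cite: Balaban1982Higgs1, (1.5) p.604] -/
theorem siteInner_cutTo_self {j : ℕ} (Λ' : Finset (HiggsLattice.Site P j)) (ψ : ScalarField P j N) :
    siteInner (cutTo Λ' ψ) (cutTo Λ' ψ) = P.mesh j ^ P.d * ∑ y ∈ Λ', ‖ψ y‖ ^ 2 := by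
  unfold siteInner
  rw [Finset.mul_sum, ← Finset.sum_filter_add_sum_filter_not Finset.univ (fun y => y ∈ Λ')]
  have h0 : ∑ y ∈ Finset.univ.filter (fun y => ¬ y ∈ Λ'), P.mesh j ^ P.d * ⟪cutTo Λ' ψ y, cutTo Λ' ψ y⟫_ℝ = 0 :=
    Finset.sum_eq_zero fun y hy => by
      rw [Finset.mem_filter] at hy
      rw [cutTo_of_not_mem Λ' ψ hy.2, inner_zero_left, mul_zero]
  rw [h0, add_zero, Finset.filter_mem_eq_inter, Finset.univ_inter]
  refine Finset.sum_congr rfl fun y hy => ?_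
  rw [cutTo_of_mem Λ' ψ hy, real_inner_self_eq_norm_sq]

/-- **(2.27) AS PRINTED**: `⟨ψ, Δ^{(k+1)}_Λ(Ω,A)ψ⟩ = a(L^{k+1}ε)^{d−2}Σ_{y∈Λ′}|ψ(y)|² − (a(L^{k+1}ε)^{−2})²⟨ψ, Q(A)C^{(k)}_Λ(Ω,A)Q^*(A)ψ⟩`
(the printed `aL^{d−2}`, `a²L^{−4}` with the scale `L^{k+1}ε` of Sect. 2.B in place of `L`; `a(L^{k+1}ε)^{d−2}` = `B1RT.prec`).
[cite: Balaban1982Higgs2, (2.27) p.562] -/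
theorem siteInner_condDelta227_printed (k : ℕ) (Λ' : Finset (HiggsLattice.Site P (k + 1))) (ψ : ScalarField P (k + 1) N) :
    siteInner ψ (condDelta227 C Ω A msq a k Λ' ψ)
      = B1RT.prec a (P.mesh (k + 1)) P.d * ∑ y ∈ Λ', ‖ψ y‖ ^ 2
        - stepCoef P a k ^ 2 *
          siteInner ψ (avgQLin C A k (condCov232 C Ω A msq a k (blockSet Λ') (avgQAdjLin C A k ψ))) := by
  rw [siteInner_condDelta227, siteInner_cutTo_self, ← mul_assoc, stepCoef_mul_mesh_pow, ← siteInner_avgQAdjLin]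

/-- `Δ^{(k+1)}_Λ(Ω,A)` is symmetric for (1.5): `⟨f, Δ_Λ g⟩ = ⟨g, Δ_Λ f⟩` (`C^{(k)}_Λ` symmetric, `Q^*` the adjoint of `Q`).
[cite: Balaban1982Higgs2, (2.27) p.562] -/
theorem siteInner_condDelta227_comm (k : ℕ) (Λ' : Finset (HiggsLattice.Site P (k + 1))) (f g : ScalarField P (k + 1) N) :
    siteInner f (condDelta227 C Ω A msq a k Λ' g) = siteInner g (condDelta227 C Ω A msq a k Λ' f) := by
  rw [condDelta227_apply, condDelta227_apply, siteInner_sub_right, siteInner_sub_right, siteInner_smul_right,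
    siteInner_smul_right, siteInner_smul_right, siteInner_smul_right, siteInner_cutTo_comm,
    ← siteInner_avgQAdjLin, ← siteInner_avgQAdjLin, siteInner_condCov232_comm]

/-- Without conditioning (`Λ′ = T^{(k+1)}`, `Λ = T^{(k)}`): `Δ^{(k+1)}_{T}(Ω,A) = a(L^{k+1}ε)^{−2}·1 − a²(L^{k+1}ε)^{−4}·Q(A)C^{(k)}(Ω,A)Q^*(A)`
with the unconditioned covariance `C^{(k)}(Ω,A)` of I (2.30) (p35's `fluctCovA`; `HiggsCondCov232.condCov232_univ`).
[cite: Balaban1982Higgs2, (2.27) p.562] -/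
theorem condDelta227_univ (k : ℕ) :
    condDelta227 C Ω A msq a k Finset.univ
      = stepCoef P a k • (1 : Module.End ℝ (ScalarField P (k + 1) N))
        - stepCoef P a k ^ 2 •
          ((avgQLin C A k : ScalarField P k N →ₗ[ℝ] ScalarField P (k + 1) N)
            ∘ₗ fluctCovA C Ω A msq a k ∘ₗ avgQAdjLin C A k) := by
  have hB : blockSet (Finset.univ : Finset (HiggsLattice.Site P (k + 1))) = (Finset.univ : Finset (HiggsLattice.Site P k)) := by
    ext x
    simp [mem_blockSet]
  rw [condDelta227, cutToLin_univ, hB, condCov232_univ]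

end Def

/-! ### The vector-field reading: *"the similar formula holds for the vector field"* (`N = d`, external field `0`) -/

section VectorField

variable (msq a : ℝ)

/-- For the VECTOR field (p. 562: *"and the similar formula holds for the vector field"*; I p. 608 *"N = d and an external
vector field A = 0"*): at the trivial coupling the conditional covariance inside (2.27) is the restricted inverse of the typer's
vector-field operator `HiggsFluctMeasure.precOp` (`HiggsCondGauss228`-style dictionary, p35's `precOpA_zero_field`).
[cite: Balaban1982Higgs2, (2.27) p.562] -/
theorem condDelta227_zero_field (k : ℕ) (Λ' : Finset (HiggsLattice.Site P (k + 1))) :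
    condDelta227 (B3MultiscaleFields.zeroCharge P.d) Finset.univ (0 : HiggsLattice.VecField P 0) msq a k Λ'
      = stepCoef P a k • (cutToLin Λ' : Module.End ℝ (ScalarField P (k + 1) P.d))
        - stepCoef P a k ^ 2 •
          ((avgQLin (B3MultiscaleFields.zeroCharge P.d) (0 : HiggsLattice.VecField P 0) k
              : ScalarField P k P.d →ₗ[ℝ] ScalarField P (k + 1) P.d)
            ∘ₗ restrictInv (blockSet Λ') (HiggsFluctMeasure.precOp P msq a k : Module.End ℝ (ScalarField P k P.d))
            ∘ₗ avgQAdjLin (B3MultiscaleFields.zeroCharge P.d) (0 : HiggsLattice.VecField P 0) k) := by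
  rw [condDelta227, condCov232, precOpA_zero_field]

end VectorField

/-! ## §2 `Λ = T^{(k)}`: (2.27) is part I's (2.21) one level up -/

section Consistency

variable (C : ChargeData N) (Ω : Finset (HiggsLattice.Site P 0)) (A : HiggsLattice.VecField P 0)

/-- `a(L^{1}ε)^{−2} = a₁(L^{1}ε)^{−2}`: the first-step coefficient is p35's/the typer's `coeff221` at level 1 (a₁ = a,
`B1.aSeq_one`). [cite: Balaban1982Higgs1, (2.15) p.609] -/
theorem stepCoef_zero_eq_coeff221 {a : ℝ} (hL : 1 < (P.L : ℝ)) : stepCoef P a 0 = coeff221 P a 1 := by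
  rw [stepCoef, coeff221_eq, B1.aSeq_one hL]

/-- **Level 0**: `Δ^{(1)}_{T}(Ω,A)` of (2.27) IS `Δ^{(1),Lε}(Ω,A)` of I (2.21) — by «G^ε_1(Ω,A) = C^{(0),ε}(Ω,A)» (I p. 612,
p35's `B1Eq243HiggsModel.propagatorK_one`), `Q₁ = Q` and `a₁ = a`; valid for every m². [cite: Balaban1982Higgs1, (2.21) p.610] -/
theorem condDelta227_univ_zero (hL : 1 < (P.L : ℝ)) (msq a : ℝ) :
    condDelta227 C Ω A msq a 0 Finset.univ = deltaKA C Ω A msq a 1 := by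
  rw [condDelta227_univ, deltaKA_succ, avgQkLin_one, avgQkAdj_one, B1Eq243HiggsModel.propagatorK_one C Ω A hL msq a,
    ← stepCoef_zero_eq_coeff221 hL]
  rfl

variable (msq a : ℝ)

/-- The identity operator has the identity matrix in p35's coordinates (`B1Eq230FluctCov.mat_id`). [cite: Balaban1982Higgs1, (1.5) p.604] -/
theorem mat_one {j : ℕ} : mat (1 : Module.End ℝ (ScalarField P j N)) = 1 := mat_id

/-- The matrix of (2.27) at `Λ = T^{(k)}` is the Schur-complement expression `β·1 − β²·QC^{(k)}Q^*` of b2b's step data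
(p35's `stepData` at level `k ≥ 1`; `β = a(L^{k+1}ε)^{−2}`). [cite: Balaban1982Higgs1, (2.18) p.610] -/
theorem mat_condDelta227_univ_succ (j : ℕ) :
    mat (condDelta227 C Ω A msq a (j + 1) Finset.univ)
      = (stepData C Ω A msq a (j + 1)).β • (1 : Matrix _ _ ℝ)
        - (stepData C Ω A msq a (j + 1)).β ^ 2 •
          ((stepData C Ω A msq a (j + 1)).Q * (stepData C Ω A msq a (j + 1)).Ck * (stepData C Ω A msq a (j + 1)).Qs) := by
  rw [stepData_Ck, condDelta227_univ, mat_sub, mat_smul, mat_smul, mat_one, mat_comp, mat_comp, ← Matrix.mul_assoc]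
  rfl

/-- The right side of b2b's `display221_succ` for p35's step data at level `k ≥ 1` IS the matrix of `Δ^{(k+1),L^{k+1}ε}(Ω,A)`
(I (2.21) at `k + 1`): `γ = a_{k+1}(L^{k+1}ε)^{−2}`, `Q_{k+1} = QQ_k`, `G_{k+1}` the inverse of the matrix of `covOpK` at `k + 1`
(a > 0, L > 1). [cite: Balaban1982Higgs1, (2.21) p.610] -/
theorem stepData_rhs221_eq {a : ℝ} (ha : 0 < a) (hL : 1 < (P.L : ℝ)) (j : ℕ) :
    (stepData C Ω A msq a (j + 1)).γ • (1 : Matrix _ _ ℝ)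
        - (stepData C Ω A msq a (j + 1)).γ ^ 2 •
          ((stepData C Ω A msq a (j + 1)).Qk1 * (stepData C Ω A msq a (j + 1)).Gk1 * (stepData C Ω A msq a (j + 1)).Qk1s)
      = mat (deltaKA C Ω A msq a (j + 2)) := by
  have hj : 1 ≤ j + 1 := by omega
  have hG1 : (stepData C Ω A msq a (j + 1)).Gk1 = (stepData C Ω A msq a (j + 2)).Gk := by
    rw [B1RG242.StepData.Gk1, B1RG242.StepData.Gk, stepData_next_arg_eq C Ω A msq ha hL hj, stepData_G_arg_eq]
  rw [stepData_γ C Ω A msq ha hL hj, stepData_Qk1, stepData_Qk1s, hG1, ← stepData_Δk C Ω A msq a (j + 1)]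
  rfl

/-- **`Λ = T^{(k)}`: (2.27) IS (I.2.21) ONE LEVEL UP, every level** — `Δ^{(k+1),L^{k+1}ε}_{T^{(k)}}(Ω,A)` of (2.27) (one more
renormalization step applied to the `k`-th covariance, the inductive definition I (2.18)) EQUALS the solved form
`a_{k+1}(L^{k+1}ε)^{−2}·1 − a_{k+1}²(L^{k+1}ε)^{−4}·Q_{k+1}(A)G^ε_{k+1}(Ω,A)Q^*_{k+1}(A)` of I (2.21) at level `k + 1`, for the
concrete covariant operators (m² > 0, a > 0, L > 1, k < K; every `Ω`, `A`, `C`).  Level 0: «G₁ = C^{(0)}»; level `k ≥ 1`: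
b2b's KERNEL `B1RG242.StepData.display221_succ` on p35's `stepData`, whose hypotheses (QQ^* = 1, α + β ≠ 0, existence of
G_k and of C^{(k)}) are p35's theorems. [cite: Balaban1982Higgs1, (2.18) p.610] -/
theorem condDelta227_univ_eq_deltaKA {msq a : ℝ} (hm : 0 < msq) (ha : 0 < a) (hL : 1 < (P.L : ℝ)) {k : ℕ} (hkK : k < P.K) :
    condDelta227 C Ω A msq a k Finset.univ = deltaKA C Ω A msq a (k + 1) := by
  cases k with
  | zero => exact condDelta227_univ_zero C Ω A hL msq a
  | succ j =>
    have hj : 1 ≤ j + 1 := by omega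
    apply mat_injective
    rw [mat_condDelta227_univ_succ, ← stepData_rhs221_eq C Ω A msq ha hL j]
    refine B1RG242.StepData.display221_succ (stepData C Ω A msq a (j + 1)) (stepData_QQs C Ω A msq a hkK) ?_
      (stepData_G_arg C Ω A hm ha hL hj) (stepData_C_arg C Ω A hm ha hL hj)
    have hα : 0 < (stepData C Ω A msq a (j + 1)).α := by
      show 0 < coeff221 P a (j + 1)
      rw [coeff221_eq]
      exact mul_pos (B1.aSeq_pos ha hL hj) (pow_pos (inv_pos.mpr (P.mesh_pos (j + 1))) 2)
    have hβ : 0 < (stepData C Ω A msq a (j + 1)).β := by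
      show 0 < a * ((P.mesh (j + 1 + 1))⁻¹ ^ 2)
      exact mul_pos ha (pow_pos (inv_pos.mpr (P.mesh_pos (j + 1 + 1))) 2)
    exact (add_pos hα hβ).ne'

/-- The form version: for every `ψ` on `T^{(k+1)}`, `⟨ψ, Δ^{(k+1)}_{T^{(k)}}(Ω,A)ψ⟩` of (2.27) `= ⟨ψ, Δ^{(k+1),L^{k+1}ε}(Ω,A)ψ⟩` of
I (2.21). [cite: Balaban1982Higgs1, (2.21) p.610] -/
theorem siteInner_condDelta227_univ {msq a : ℝ} (hm : 0 < msq) (ha : 0 < a) (hL : 1 < (P.L : ℝ)) {k : ℕ} (hkK : k < P.K)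
    (ψ : ScalarField P (k + 1) N) :
    siteInner ψ (condDelta227 C Ω A msq a k Finset.univ ψ) = siteInner ψ (deltaKA C Ω A msq a (k + 1) ψ) := by
  rw [condDelta227_univ_eq_deltaKA C Ω A hm ha hL hkK]

end Consistency

/-! ## §3 (v1.1) (2.47) p. 568: the exact split of `½⟨φ, Δ^{(k)}_{Λ₅}φ⟩` at `Λ₆′` for the concrete operator -/

section Split247

variable (C : ChargeData N) (Ω : Finset (HiggsLattice.Site P 0)) (A : HiggsLattice.VecField P 0) (msq a : ℝ)

/-- The algebra behind (2.47) p. 568 for the scalar product (1.5): for an operator `M` symmetric for `⟨·,·⟩` and any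
decomposition `u + v`, `½⟨u+v, M(u+v)⟩ = ½⟨u, Mu⟩ + ⟨u, Mv⟩ + ½⟨v, Mv⟩` (the two cross terms coincide by symmetry — this is why
(2.47) carries its middle term without the factor ½; r14's `B2Sect2BDensities.half_quadForm_split` is the matrix twin).
[cite: Balaban1982Higgs2, (2.47) p.568] -/
theorem half_siteInner_split {j : ℕ} (M : Module.End ℝ (ScalarField P j N))
    (hM : ∀ f g : ScalarField P j N, siteInner f (M g) = siteInner g (M f)) (u v : ScalarField P j N) :
    (1 / 2 : ℝ) * siteInner (u + v) (M (u + v))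
      = (1 / 2 : ℝ) * siteInner u (M u) + siteInner u (M v) + (1 / 2 : ℝ) * siteInner v (M v) := by
  rw [map_add, siteInner_add_right, siteInner_comm (u + v) (M u), siteInner_comm (u + v) (M v), siteInner_add_right,
    siteInner_add_right, siteInner_comm (M u) u, siteInner_comm (M u) v, siteInner_comm (M v) u, siteInner_comm (M v) v,
    hM v u]
  ring

/-- `Sᶜψ + Sψ = ψ` (complementary characteristic functions). [cite: Balaban1982Higgs2, (2.47) p.568] -/
theorem cutTo_compl_add_cutTo {j : ℕ} (S : Finset (HiggsLattice.Site P j)) (ψ : ScalarField P j N) :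
    cutTo Sᶜ ψ + cutTo S ψ = ψ := by
  funext x
  by_cases hx : x ∈ S
  · rw [Pi.add_apply, cutTo_of_mem S ψ hx, cutTo_of_not_mem Sᶜ ψ (fun h => (Finset.mem_compl.mp h) hx), zero_add]
  · rw [Pi.add_apply, cutTo_of_not_mem S ψ hx, cutTo_of_mem Sᶜ ψ (Finset.mem_compl.mpr hx), add_zero]

/-- **(2.47) p. 568, its exact skeleton, for the CONCRETE operator `Δ^{(k+1)}_Λ(Ω,A)` of (2.27)**: with `S` ↤ `Λ₆^{(k−1)′}`
(a region of the lattice of the new field) and `Δ_Λ = condDelta227 C Ω A msq a k Λ′`,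
`½⟨ψ, Δ_Λψ⟩ = ½⟨Sᶜψ, Δ_ΛSᶜψ⟩ + ⟨Sᶜψ, Δ_ΛSψ⟩ + ½⟨Sψ, Δ_ΛSψ⟩` — no error term; the printed (2.47) then replaces, term by
term, `(Ω, A)` by `(B^{k−1}(Λ₂ ∩ Λ₇ᶜ), A)` and the mask `S` by `S ∩ Λ₇′ᶜ` at the cost `O((L^{k−1}ε)^κ)|Λ₆^{(k−1)}|` (r14's
`B2Sect2BDensities.eq247_of_replacements`, over matrices).  *"and similarly for the form ⟨A, Δ^{(k)}_{Λ₅}A⟩"* = the case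
`N = d`, external field `0` (`condDelta227_zero_field`). [cite: Balaban1982Higgs2, (2.47) p.568] -/
theorem half_siteInner_condDelta227_split (k : ℕ) (Λ' S : Finset (HiggsLattice.Site P (k + 1)))
    (ψ : ScalarField P (k + 1) N) :
    (1 / 2 : ℝ) * siteInner ψ (condDelta227 C Ω A msq a k Λ' ψ)
      = (1 / 2 : ℝ) * siteInner (cutTo Sᶜ ψ) (condDelta227 C Ω A msq a k Λ' (cutTo Sᶜ ψ))
        + siteInner (cutTo Sᶜ ψ) (condDelta227 C Ω A msq a k Λ' (cutTo S ψ))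
        + (1 / 2 : ℝ) * siteInner (cutTo S ψ) (condDelta227 C Ω A msq a k Λ' (cutTo S ψ)) := by
  conv_lhs => rw [← cutTo_compl_add_cutTo S ψ]
  exact half_siteInner_split (condDelta227 C Ω A msq a k Λ') (siteInner_condDelta227_comm C Ω A msq a k Λ') _ _

end Split247

end Literature.MathematicalPhysics.QuantumFieldTheory.Balaban1983to89.B2Eq227CondDelta
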